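import Mathlib.NumberTheory.SumPrimeReciprocals
import Summits.ABC.ABC.Theorems.DefiniteXiPeterssonLowerBoundStubSymmSqLLogEulerLocal
import Literature.NumberTheory.EllipticCurves.RankinSymmSquareGL2Fields
import HarnessLib

/-!
# Stub `stub_symmSqL_logEuler` of the crux skeleton `DefiniteXi.PeterssonLowerBound` (stmt-ABC-10870), line Sketch: log-Euler product of `symmSqL N f · ∏_{p∣N}(1+p^{-s})` on `Re s > 1`

For a newform `f ∈ S₂(Γ₀(N))` (`IsNewform0 f`) with the Ramanujan bound `|a_p| ≤ 2√p` at the good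
primes and `Re s > 1`, with `y = p^{-s}` and `P_k = C_k(a_p/√p)` (Chebyshev `C`):
`L_f(s) · ∏_{p∣N}(1 + p^{-s}) = exp(Σ_p Σ_{k≥1} b(p^k) y^k)`, `b(p^k) = (P_k² − 1)/k` (`p ∤ N`),
`p^{-k}/k` (`p ∥ N`), `0` (`p² ∣ N`), all series converging absolutely
(`stub_symmSqL_logEuler`). Proof: `L_f = ζ(2s) L(|a|², s+1)/ζ(s)` (`symmSqL_eq_of_one_lt_re`) is
the product of three Euler products (`riemannZeta_eulerProduct_hasProd` twice and
`symmSqLog_hasProd_LSeries_normSq`) and the finite correction; prime by prime the local factor is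
the exponential of the local log-series (`symmSqLog_exp_tsum_local_eq`: at `p ∤ N` both are
`((1 − y)(1 − (a_p²/p − 2)y + y²))⁻¹`, at `p ∥ N` both are `(1 − y/p)⁻¹`, at `p² ∣ N` both are
`1`), and `exp(Σ_p Λ_p) = ∏'_p exp Λ_p` (`HasSum.cexp`) with uniqueness of limits.

## References

* D. Bump, *Automorphic forms and representations* (1997), §3.9. [Bump1997]
-/

noncomputable section

open scoped Real Topology
open Set Filter Metric Complex CongruenceSubgroup
open Literature.NumberTheory.EllipticCurves.ModularForms

-- the summit-side namespace `Summit.ABC.ABC.Theorems` (summit = problem = `ABC`) is fixed by the tree layout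
set_option linter.dupNamespace false

namespace Summit.ABC.ABC.Theorems

variable {N : ℕ} [NeZero N]

/-- **The local identity at every prime.** With `y = p^{-s}`, `Re s > 1`: the exponential of the
local log-series `Σ_k b(p^k) y^k` equals
`(Σ_e a_{p^e}² (y/p)^e) · (1 − y²)⁻¹ · (1 − y) · (p ∣ N ? 1 + y : 1)`, i.e. the local factor of
`ζ(2s) L(|a|², s+1) ζ(s)⁻¹ ∏_{p∣N}(1 + p^{-s})`: at `p ∤ N` both sides are
`((1 − y)(1 − (a_p²/p − 2) y + y²))⁻¹`, at `p ∥ N` both are `(1 − y/p)⁻¹`, at `p² ∣ N` both are `1`.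
[cite: Bump1997, §3.9] -/
theorem symmSqLog_exp_tsum_local_eq {f : CuspForm (Gamma0 N) 2} (hf : IsNewform0 f)
    (hR : ∀ p : ℕ, p.Prime → ¬ p ∣ N → |(cuspCoeff f p).re| ≤ 2 * Real.sqrt p)
    {s : ℂ} (hs : 1 < s.re) {p : ℕ} (hp : p.Prime)
    (hEs : Summable fun e : ℕ ↦ cuspCoeff f (p ^ e) ^ 2 * ((p : ℂ) ^ (-(s + 1))) ^ e) :
    Complex.exp (∑' k : ℕ,
        ((if ¬ p ∣ N then
            (((Polynomial.Chebyshev.C ℝ (k + 1)).eval ((cuspCoeff f p).re / Real.sqrt p)) ^ 2 - 1) /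
              (k + 1)
          else if ¬ p ^ 2 ∣ N then ((p : ℝ) ^ (k + 1))⁻¹ / (k + 1) else 0 : ℝ) : ℂ) *
        (p : ℂ) ^ (-((k + 1 : ℕ) : ℂ) * s)) =
      (∑' e : ℕ, cuspCoeff f (p ^ e) ^ 2 * ((p : ℂ) ^ (-(s + 1))) ^ e) *
        (1 - (p : ℂ) ^ (-(2 * s)))⁻¹ * (1 - (p : ℂ) ^ (-s)) *
        (if p ∣ N then 1 + (p : ℂ) ^ (-s) else 1) := by
  have hp0 : (p : ℂ) ≠ 0 := by exact_mod_cast hp.ne_zero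
  have hp1 : (1 : ℝ) < p := by exact_mod_cast hp.one_lt
  have hx : (p : ℂ) ^ (-(s + 1)) = (p : ℂ) ^ (-s) / p := by
    rw [neg_add', Complex.cpow_sub _ _ hp0, Complex.cpow_one]
  have h2s : (p : ℂ) ^ (-(2 * s)) = ((p : ℂ) ^ (-s)) ^ 2 := by
    rw [show -(2 * s) = ((2 : ℕ) : ℂ) * (-s) by push_cast; ring, Complex.cpow_nat_mul]
  have hpow : ∀ k : ℕ, (p : ℂ) ^ (-((k + 1 : ℕ) : ℂ) * s) = ((p : ℂ) ^ (-s)) ^ (k + 1) := fun k ↦ by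
    rw [show -((k + 1 : ℕ) : ℂ) * s = ((k + 1 : ℕ) : ℂ) * (-s) by ring, Complex.cpow_nat_mul]
  simp_rw [hpow]
  rw [hx] at hEs
  rw [hx, h2s]
  set y : ℂ := (p : ℂ) ^ (-s) with hy
  have hynorm : ‖y‖ = (p : ℝ) ^ (-s.re) := by
    rw [hy, Complex.norm_natCast_cpow_of_pos hp.pos, Complex.neg_re]
  have hy1 : ‖y‖ < 1 := by
    rw [hynorm]; exact Real.rpow_lt_one_of_one_lt_of_neg hp1 (by linarith)
  have hyp : ‖y / p‖ < 1 := by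
    rw [norm_div, Complex.norm_natCast]
    exact (div_le_self (norm_nonneg _) hp1.le).trans_lt hy1
  obtain ⟨h1y, h1y'⟩ := symmSqLog_one_sub_ne_zero hy1
  have hysq : 1 - y ^ 2 = (1 - y) * (1 + y) := by ring
  rw [hysq]
  by_cases hpN : p ∣ N
  · rw [if_pos hpN]
    simp only [hpN, not_true_eq_false, if_false]
    by_cases hp2 : p ^ 2 ∣ N
    · simp only [hp2, not_true_eq_false, if_false, Complex.ofReal_zero, zero_mul, tsum_zero,
        Complex.exp_zero]
      rw [symmSqLog_tsum_sq_cuspCoeff_of_sq_dvd hf hp hp2]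
      field_simp
    · simp only [hp2, not_false_eq_true, if_true]
      obtain ⟨Λ, hΛ, hexp⟩ := symmSqLog_exists_hasSum_mult hp1.le hy1
      have h3 : 1 - y / p ≠ 0 := (symmSqLog_one_sub_ne_zero hyp).1
      rw [hΛ.tsum_eq, hexp, symmSqLog_tsum_sq_cuspCoeff_of_dvd hf hp hpN hp2 hyp,
        Complex.ofReal_natCast]
      field_simp
  · rw [if_neg hpN]
    simp only [hpN, not_false_eq_true, if_true]
    have hsp : 0 < Real.sqrt p := Real.sqrt_pos.mpr (by exact_mod_cast hp.pos)
    set a : ℝ := (cuspCoeff f p).re with ha_def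
    have ha : cuspCoeff f p = (a : ℂ) := hf.cuspCoeff_eq_ofReal_re p
    have ht : |a / Real.sqrt p| ≤ 2 := by
      rw [abs_div, abs_of_pos hsp, div_le_iff₀ hsp]; exact hR p hp hpN
    obtain ⟨Λ, hΛ, hexp⟩ := symmSqLog_exists_hasSum_good ht hy1
    set T : ℂ := (((a / Real.sqrt p) ^ 2 - 2 : ℝ) : ℂ) with hT_def
    have hT : T * p = (a : ℂ) ^ 2 - 2 * p := by
      have hsq : (a / Real.sqrt p) ^ 2 = a ^ 2 / p := by rw [div_pow, Real.sq_sqrt (Nat.cast_nonneg p)]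
      have h : ((a / Real.sqrt p) ^ 2 - 2) * p = a ^ 2 - 2 * p := by
        rw [hsq]; field_simp
      rw [hT_def]; exact_mod_cast h
    have hcubic := symmSqLog_tsum_sq_mul_pow_mul_cubic (u := fun e ↦ cuspCoeff f (p ^ e)) (a := (a : ℂ))
      (p := (p : ℂ)) (x := y / p) (by simp [show cuspCoeff f 1 = 1 from hf.2.2]) (by simp [ha])
      (fun e ↦ by
        show cuspCoeff f (p ^ (e + 2)) = _
        rw [hf.cuspCoeff_prime_pow_add_two hp e, if_neg hpN, ha]) hEs
    have hpy : (p : ℂ) * (y / p) = y := by field_simp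
    rw [show ((a : ℂ) ^ 2 - 2 * p) * (y / p) = T * ((p : ℂ) * (y / p)) by rw [← mul_assoc, hT],
      show (p : ℂ) ^ 2 * (y / p) ^ 2 = ((p : ℂ) * (y / p)) ^ 2 by ring, hpy] at hcubic
    rw [hΛ.tsum_eq, hexp, mul_one]
    have hD : (1 - y) * (1 - T * y + y ^ 2) ≠ 0 := by
      intro h; rw [h, inv_zero] at hexp; exact Complex.exp_ne_zero _ hexp
    have hQ : 1 - T * y + y ^ 2 ≠ 0 := fun h ↦ hD (by rw [h, mul_zero])
    generalize (∑' e : ℕ, cuspCoeff f (p ^ e) ^ 2 * (y / p) ^ e) = E at hcubic ⊢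
    have hE' : E = (1 + y) * ((1 - y) * (1 - T * y + y ^ 2))⁻¹ := by
      rw [← hcubic, mul_inv_cancel_right₀ hD]
    rw [hE']
    field_simp

/-! ### The stub -/

/-- **Log-Euler product of the continued imprimitive symmetric square.** For a newform
`f ∈ S₂(Γ₀(N))` with `|a_p| ≤ 2√p` at `p ∤ N` and `Re s > 1`:
`L_f(s) · ∏_{p ∣ N}(1 + p^{-s}) = exp(Σ_p Σ_{k ≥ 1} b(p^k) p^{-ks})`, where, with
`P_k = C_k(a_p/√p)` (Chebyshev `C`, `C_k(2cos θ) = 2cos kθ`): `b(p^k) = (P_k² - 1)/k` at `p ∤ N`,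
`p^{-k}/k` at `p ∥ N`, `0` at `p² ∣ N`; all series converge absolutely. (Local factors of
`ζ(2s)L(|a|², s+1)/ζ(s)`: `NewformPeterssonSizeSymmSquareProofs`.) [cite: Bump1997, §3.9] -/
theorem stub_symmSqL_logEuler (N : ℕ) [NeZero N] (f : CuspForm (Gamma0 N) 2) (hf : IsNewform0 f)
    (hR : ∀ p : ℕ, p.Prime → ¬ p ∣ N → |(cuspCoeff f p).re| ≤ 2 * Real.sqrt p)
    {s : ℂ} (hs : 1 < s.re) :
    (∀ p : Nat.Primes, Summable fun k : ℕ ↦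
      ‖((if ¬ (p : ℕ) ∣ N then
            (((Polynomial.Chebyshev.C ℝ (k + 1)).eval ((cuspCoeff f p).re / Real.sqrt p)) ^ 2 - 1) /
              (k + 1)
          else if ¬ (p : ℕ) ^ 2 ∣ N then ((p : ℝ) ^ (k + 1))⁻¹ / (k + 1) else 0 : ℝ) : ℂ) *
        (p : ℂ) ^ (-((k + 1 : ℕ) : ℂ) * s)‖) ∧
    (Summable fun p : Nat.Primes ↦ ∑' k : ℕ,
      ‖((if ¬ (p : ℕ) ∣ N then
            (((Polynomial.Chebyshev.C ℝ (k + 1)).eval ((cuspCoeff f p).re / Real.sqrt p)) ^ 2 - 1) /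
              (k + 1)
          else if ¬ (p : ℕ) ^ 2 ∣ N then ((p : ℝ) ^ (k + 1))⁻¹ / (k + 1) else 0 : ℝ) : ℂ) *
        (p : ℂ) ^ (-((k + 1 : ℕ) : ℂ) * s)‖) ∧
    symmSqL N f s * ∏ p ∈ N.primeFactors, (1 + (p : ℂ) ^ (-s)) =
      Complex.exp (∑' p : Nat.Primes, ∑' k : ℕ,
        ((if ¬ (p : ℕ) ∣ N then
            (((Polynomial.Chebyshev.C ℝ (k + 1)).eval ((cuspCoeff f p).re / Real.sqrt p)) ^ 2 - 1) /
              (k + 1)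
          else if ¬ (p : ℕ) ^ 2 ∣ N then ((p : ℝ) ^ (k + 1))⁻¹ / (k + 1) else 0 : ℝ) : ℂ) *
        (p : ℂ) ^ (-((k + 1 : ℕ) : ℂ) * s)) := by
  have hN0 : N ≠ 0 := NeZero.ne N
  have hσ : -s.re < -1 := by linarith
  -- `‖p^{-s}‖ = p^{-σ} ≤ 1/2` and `p^{-(k+1)s} = (p^{-s})^{k+1}`
  have hy : ∀ p : Nat.Primes, ‖((p : ℕ) : ℂ) ^ (-s)‖ = (p : ℝ) ^ (-s.re) ∧
      ‖((p : ℕ) : ℂ) ^ (-s)‖ ≤ 1 / 2 := by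
    intro p
    have h := Complex.norm_natCast_cpow_of_pos p.2.pos (-s)
    rw [Complex.neg_re] at h
    refine ⟨h, ?_⟩
    rw [h, Real.rpow_neg (Nat.cast_nonneg _), one_div]
    have h2 : (2 : ℝ) ≤ (p : ℝ) ^ s.re :=
      calc (2 : ℝ) ≤ p := by exact_mod_cast p.2.two_le
        _ = (p : ℝ) ^ (1 : ℝ) := (Real.rpow_one _).symm
        _ ≤ (p : ℝ) ^ s.re :=
          Real.rpow_le_rpow_of_exponent_le (by exact_mod_cast p.2.one_lt.le) hs.le
    exact inv_anti₀ (by norm_num) h2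
  have hpow : ∀ (p : Nat.Primes) (k : ℕ),
      ((p : ℕ) : ℂ) ^ (-((k + 1 : ℕ) : ℂ) * s) = (((p : ℕ) : ℂ) ^ (-s)) ^ (k + 1) := fun p k ↦ by
    rw [show -((k + 1 : ℕ) : ℂ) * s = ((k + 1 : ℕ) : ℂ) * (-s) by ring, Complex.cpow_nat_mul]
  have hloc : ∀ p : Nat.Primes, (Summable fun k : ℕ ↦
      ‖((if ¬ (p : ℕ) ∣ N then
            (((Polynomial.Chebyshev.C ℝ (k + 1)).eval ((cuspCoeff f p).re / Real.sqrt p)) ^ 2 - 1) /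
              (k + 1)
          else if ¬ (p : ℕ) ^ 2 ∣ N then ((p : ℝ) ^ (k + 1))⁻¹ / (k + 1) else 0 : ℝ) : ℂ) *
        (p : ℂ) ^ (-((k + 1 : ℕ) : ℂ) * s)‖) ∧
      ∑' k : ℕ, ‖((if ¬ (p : ℕ) ∣ N then
            (((Polynomial.Chebyshev.C ℝ (k + 1)).eval ((cuspCoeff f p).re / Real.sqrt p)) ^ 2 - 1) /
              (k + 1)
          else if ¬ (p : ℕ) ^ 2 ∣ N then ((p : ℝ) ^ (k + 1))⁻¹ / (k + 1) else 0 : ℝ) : ℂ) *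
        (p : ℂ) ^ (-((k + 1 : ℕ) : ℂ) * s)‖ ≤ 6 * (p : ℝ) ^ (-s.re) := by
    intro p
    obtain ⟨hn, hle⟩ := hy p
    have h := symmSqLog_summable_norm_mul_pow_succ (fun k ↦ symmSqLog_abs_coeff_le hR p.2 k) hle
    rw [hn] at h
    simp_rw [hpow]
    exact h
  refine ⟨fun p ↦ (hloc p).1, ?_, ?_⟩
  · exact Summable.of_nonneg_of_le (fun p ↦ tsum_nonneg fun _ ↦ norm_nonneg _) (fun p ↦ (hloc p).2)
      ((Nat.Primes.summable_rpow.mpr hσ).mul_left 6)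
  · -- the Euler products of `L(|a|², s+1)`, `ζ(2s)`, `ζ(s)⁻¹` and the finite correction
    obtain ⟨hE, hEs⟩ := symmSqLog_hasProd_LSeries_normSq hf hs
    have h2 : 1 < (2 * s).re := by simp only [mul_re, re_ofNat, im_ofNat, zero_mul, sub_zero]; linarith
    have hζ2 := riemannZeta_eulerProduct_hasProd h2
    have hζ : HasProd (fun p : Nat.Primes ↦ 1 - ((p : ℕ) : ℂ) ^ (-s)) (riemannZeta s)⁻¹ := by
      have h0 : Tendsto (fun S : Finset Nat.Primes ↦ ∏ p ∈ S, (1 - ((p : ℕ) : ℂ) ^ (-s))⁻¹) atTop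
          (𝓝 (riemannZeta s)) := riemannZeta_eulerProduct_hasProd hs
      have h1 := h0.inv₀ (riemannZeta_ne_zero_of_one_le_re hs.le)
      simp_rw [← Finset.prod_inv_distrib, inv_inv] at h1
      exact h1
    have hP := ((hE.mul hζ2).mul hζ).mul (symmSqLog_hasProd_corr hN0 s)
    -- the logarithmic side
    have hΛ : Summable fun p : Nat.Primes ↦ ∑' k : ℕ,
        ((if ¬ (p : ℕ) ∣ N then
            (((Polynomial.Chebyshev.C ℝ (k + 1)).eval ((cuspCoeff f p).re / Real.sqrt p)) ^ 2 - 1) /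
              (k + 1)
          else if ¬ (p : ℕ) ^ 2 ∣ N then ((p : ℝ) ^ (k + 1))⁻¹ / (k + 1) else 0 : ℝ) : ℂ) *
        (p : ℂ) ^ (-((k + 1 : ℕ) : ℂ) * s) :=
      Summable.of_norm_bounded ((Nat.Primes.summable_rpow.mpr hσ).mul_left 6)
        fun p ↦ (norm_tsum_le_tsum_norm (hloc p).1).trans (hloc p).2
    have hP' := hΛ.hasSum.cexp
    have key := hP.unique (hP'.congr_fun fun p ↦ (symmSqLog_exp_tsum_local_eq hf hR hs p.2 (hEs p.2)).symm)
    rw [symmSqL_eq_of_one_lt_re f hs, ← key]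
    ring

end Summit.ABC.ABC.Theorems

end
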